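import Summits.BirchSwinnertonDyer.BirchSwinnertonDyer.Theses.TameQuarticSolvent
import Summits.BirchSwinnertonDyer.BirchSwinnertonDyer.Theses.TameQuarticManinParity
import HarnessLib

/-!
# Route `TameQuarticSolvent`, crux #3 `TprimeRankOneUpperAtThree` (stmt-BirchSwinnertonDyer-21392) —
# BY NAME from route `TameQuarticManinParity`'s cruxes 2–4 (the Manin binder keyed by name; no restatement)

HONEST FRAMING. Theorems only; helper (`--supports stmt-BirchSwinnertonDyer-21392 --as helper`), CONDITIONAL on
every displayed hypothesis; credits nothing toward closing the item; BSD is not proved by any of this. No new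
definition, no new named fact, no restatement of either route's cruxes (both route files are imported and their
decls are used BY NAME).

WHAT. Route `TameQuarticSolvent` (TQS) files crux #3 `TprimeRankOneUpperAtThree` — the Euler-system UPPER half
`ord₃ #Ш(E) ≤ ord₃ #Ш_an(E)` (`Typed.MissingUpperBoundAt E 3`) on the non-CM (t′) rank-ONE rows at `3` — and names
in its why-might-fail the Manin constant at the additive prime `3`. Route `TameQuarticManinParity` (TQMP, director-bsd
00:25:55Z: «the MANIN-BINDER SUPPLIER of TameQuarticSolvent … key the Manin binder of 21392 BY NAME to TQMP's decls»)
isolates exactly that binder: X₂ = `TprimeIrreducibleManinUnit` (stmt-BirchSwinnertonDyer-23736), X₃ =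
`TprimeReducibleManinUnit` (23737) — `3 ∤ c` for the `X₀(N)`-optimal datum on the (t′) rows — and X₄ =
`TprimeHeegnerUpperOfManinUnit` (23738) := X₂ → X₃ → (the upper half on the non-CM (t′) rank-one rows). This file
records, in the kernel:
* `tprimeHeegnerUpperOfManinUnit_iff` — TQMP's X₄ is LITERALLY «X₂ → X₃ → TQS crux #3» (`Iff.rfl` after unfolding);
* `tprimeRankOneUpperAtThree_of_maninUnit_of_heegnerUpper` — TQS crux #3 ⟸ X₂ ∧ X₃ ∧ X₄, BY NAME;
* `tprimeHeegnerUpperOfManinUnit_of_tprimeRankOneUpperAtThree` — conversely X₄ ⟸ TQS crux #3 (the Manin units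
  are then not even needed): the two items are inter-derivable, X₄ being the weaker obligation.
So crux #3 of TQS carries no obligation beyond TQMP's {X₂, X₃, X₄}; and a proof of TQS crux #3 closes TQMP's X₄.

References: B. Edixhoven, in: Arithmetic Algebraic Geometry (Texel 1989), Progr. Math. 89 (1991) §3–§4;
V. A. Kolyvagin, Euler systems (1990); B. Gross, D. Zagier, Invent. Math. 84 (1986); R. L. Miller, LMS J. Comput.
Math. 14 (2011) Def. 1.1.
-/

-- D-0017: single-problem summit, so `Summit.BirchSwinnertonDyer.BirchSwinnertonDyer.…` repeats a namespace BY DESIGN.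
set_option linter.dupNamespace false
set_option autoImplicit false

namespace Summit.BirchSwinnertonDyer.BirchSwinnertonDyer.Theorems.TprimeRankOneUpperAtThree

open Summit.BirchSwinnertonDyer.BirchSwinnertonDyer.Theses

/-- **TQMP's crux 4 is literally «Manin units ⟹ TQS crux #3».** The route decl
`TameQuarticManinParity.TprimeHeegnerUpperOfManinUnit` (stmt-BirchSwinnertonDyer-23738) unfolds to
`TprimeIrreducibleManinUnit → TprimeReducibleManinUnit → TameQuarticSolvent.TprimeRankOneUpperAtThree`
(stmt-BirchSwinnertonDyer-21392) — same binders, same conclusion `Typed.MissingUpperBoundAt W 3`. [folklore] -/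
theorem tprimeHeegnerUpperOfManinUnit_iff :
    TameQuarticManinParity.TprimeHeegnerUpperOfManinUnit ↔
      (TameQuarticManinParity.TprimeIrreducibleManinUnit → TameQuarticManinParity.TprimeReducibleManinUnit →
        TameQuarticSolvent.TprimeRankOneUpperAtThree) :=
  Iff.rfl

/-- **TQS crux #3 BY NAME from TQMP's cruxes 2–4.** GIVEN the two Manin `3`-units on the (t′) rows
(`TprimeIrreducibleManinUnit`, stmt-BirchSwinnertonDyer-23736; `TprimeReducibleManinUnit`, 23737) and the Heegner
upper half granted them (`TprimeHeegnerUpperOfManinUnit`, 23738), the route decl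
`TameQuarticSolvent.TprimeRankOneUpperAtThree` (stmt-BirchSwinnertonDyer-21392) holds. CONDITIONAL; credits nothing;
none of the three hypothesis items is proved here. [cite: EdixhovenManin1991, §3–§4] [cite: Miller2011LMS, Def. 1.1] -/
theorem tprimeRankOneUpperAtThree_of_maninUnit_of_heegnerUpper
    (h₂ : TameQuarticManinParity.TprimeIrreducibleManinUnit)
    (h₃ : TameQuarticManinParity.TprimeReducibleManinUnit)
    (h₄ : TameQuarticManinParity.TprimeHeegnerUpperOfManinUnit) :
    TameQuarticSolvent.TprimeRankOneUpperAtThree :=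
  fun W _ _ hCM hadd hsub hr => h₄ h₂ h₃ W hCM hadd hsub hr

/-- **Conversely, TQMP's crux 4 from TQS crux #3** (the Manin-unit hypotheses are discarded): a proof of
`TameQuarticSolvent.TprimeRankOneUpperAtThree` (21392) closes `TameQuarticManinParity.TprimeHeegnerUpperOfManinUnit`
(23738) by this term. CONDITIONAL; credits nothing. [folklore] -/
theorem tprimeHeegnerUpperOfManinUnit_of_tprimeRankOneUpperAtThree
    (h : TameQuarticSolvent.TprimeRankOneUpperAtThree) :
    TameQuarticManinParity.TprimeHeegnerUpperOfManinUnit :=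
  fun _ _ W _ _ hCM hadd hsub hr => h W hCM hadd hsub hr

end Summit.BirchSwinnertonDyer.BirchSwinnertonDyer.Theorems.TprimeRankOneUpperAtThree
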